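import Mathlib
import Summits.Ventures.HodgeRepro.Statements
import Summits.Ventures.HodgeRepro.LitSeesaw
import Summits.Ventures.HodgeRepro.MuTableSeesaw

/-!
# The sealed seesaw data satisfy Landherr's invariants (discharge of `Lit.SeesawDatum_landherrInvariants`)

Blind cell `pub-hodge-repro`, seat p2.  The lit seat's `LitSeesaw.lean` transcribes Deligne 1982 (LNM 900) Prop. 4.1
(Landherr) for diagonal hermitian planes and records, as the unproved Prop `SeesawDatum_landherrInvariants`, its ⇒ half
applied to the field `iso` of a sealed `MuTable.SeesawDatum`: equal signatures at every infinite place and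
norm-equivalent discriminants.  `MuTableSeesaw.lean` proves both invariances directly from the `2 × 2` congruence
(`SeesawDatum.posCount_eq`, `SeesawDatum.disc_normEquiv`); this file only matches the vocabularies.
-/

set_option autoImplicit false

namespace Summit.Ventures.HodgeRepro

open NumberField MuTable

/-- **`Lit.SeesawDatum_landherrInvariants` holds**: for every sealed seesaw datum, the planes `diag(a₀, a₁)` and
`diag(a₂, a₃)` have the same number of positive entries at every infinite place, and `a₀a₁ ≡ a₂a₃` modulo the norms
`x x̄` (the ⇒ half of Landherr's classification, proved by hand from the congruence). -/
theorem Lit.SeesawDatum_landherrInvariants_holds : Lit.SeesawDatum_landherrInvariants := by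
  intro L _ _ _ S
  refine ⟨fun w => ?_, ?_⟩
  · unfold Lit.posCount Lit.posAt
    have h := S.posCount_eq w
    simp only [SeesawDatum.r_def] at h
    convert h
  · exact S.disc_normEquiv

end Summit.Ventures.HodgeRepro
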